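import Summits.ValiantsHypothesis.ValiantsHypothesis.Theorems.LacunarySymmetroidMatrixDescartesNsdPivotLoneSingular

/-!
# `MatrixDescartes` (stmt-ValiantsHypothesis-18050) — the END LAW in full: ANY pivot index, EVERY size —
# a singular lone letter takes one off gen 26's index-graded Descartes budget

HONEST FRAMING.  Cell `pub-symmetroid`, seat `val-sym-mdr-p2` (gen 27); helper file `--supports` the crux
`Theses.LacunarySymmetroid.MatrixDescartes` (OPEN), NO closure claim.  Fourth file of the day's END-LAW series; it closes the series by
removing both the negative-semidefiniteness of `…NsdPivotLoneSingular` and the size restriction of `…PivotTwoLoneRankOne`: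

* `card_posRoots_succ_le_two_mul_card_of_top_mem` (polynomials, NO SIGN HYPOTHESIS): if every negative coefficient of `f` lies in the
  budget `T` and some `n₀ ∈ T` bounds the support of `f` from above, then `Z₊(f) + 1 ≤ 2·#T` — either `coeff n₀ < 0` and the last sign run is
  negative, or `coeff n₀ ≥ 0` and `n₀` leaves the negative support (gen 27 #1's lemma covers the first branch).
* **`indexGraded_succ_of_lone_above`**: pivot pencil `X^e J + ∑ₖ X^{dₖ} Pₖ` of size `m + 1`, `Pₖ ⪰ 0`, pivot of index `≤ q` in the sense of
  `…CensusPivotDefs` (`J + WWᵀ ⪰ 0`, `W` real `(m+1) × q`) with `q ≥ 1`, ONE letter `k₀` strictly above the pivot exponent, all others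
  strictly below, `det P_{k₀} = 0` ⇒ **`Z₊ + 1 ≤ 2·∑_{j odd ≤ min q (m+1)} C(K + m + 1 − j, K)`** — gen 26's `pivotRootLawAt_indexGraded` budget
  MINUS ONE (the Cauchy–Binet part is gen 26's proof verbatim; the top exponent `e + m·d k₀` is the odd level `j = 1` with the multiset
  `{k₀,…,k₀}`; nothing lies above it by `NsdLoneSingular.coeff_det_eq_zero_above`).  Mirror **`indexGraded_succ_of_lone_below`**.
* Instances: `m + 1 = 2` gives `2K + 1` (= `…PivotTwoLoneRankOne`, which also has the rank-free «good branch» `≤ 2K`); `S₀ = 0` is weaker than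
  the NSD file (whose budget counts letter multisets only); **index one, every size**: `indexOne_succ_of_lone_above` —
  `Z₊ + 1 ≤ 2·C(K + m, K)` on these supports (the resolvent–Descartes budget `2·C(K + m, m)` of `Pivot.rankOneResolventDescartes_holds`, gen 3,
  minus one).
Nothing here bears on `MatrixDescartes` in its window, on `stub_twoSided`, on `DoorA26` / `DoorA34`, on the cell's registers, or on `VP ≠ VNP`.

[folklore] Cauchy–Binet sign bookkeeping (gen 26 `…PivotIndexGraded`, copied with the budget lemma replaced) + gen 26 `…PencilEnds`;
no definitions, no named facts.
-/

-- `Summit.ValiantsHypothesis.ValiantsHypothesis.…` repeats a component by the D-0017 layout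
-- (single-conjunct summit), which the `dupNamespace` linter flags; the name is mandated.
set_option linter.dupNamespace false

namespace Summit.ValiantsHypothesis.ValiantsHypothesis.Theorems.LacunarySymmetroidMatrixDescartes.Pivot.IndexGradedLoneSingular

open Polynomial Matrix Finset IndexGraded
open scoped BigOperators MatrixOrder
open Pivot.TwoDescartes (negSupp signVariations_add_le_two_mul_card_negSupp card_posRoots_le_two_mul_card)

variable {m K q : ℕ}

/-! ## 1. The end lemma without a sign hypothesis -/

/-- **Budget with a top element, no sign hypothesis.**  If every negative coefficient of `f` has its exponent in `T`, `n₀ ∈ T`, and no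
exponent above `n₀` occurs in `f`, then `Z₊(f) + 1 ≤ 2·#T`. [folklore] -/
theorem card_posRoots_succ_le_two_mul_card_of_top_mem (f : ℝ[X]) (T : Finset ℕ) (hT : ∀ n, f.coeff n < 0 → n ∈ T) {n₀ : ℕ}
    (hn₀ : n₀ ∈ T) (habove : ∀ n, n₀ < n → f.coeff n = 0) :
    (f.roots.toFinset.filter (fun t => 0 < t)).card + 1 ≤ 2 * T.card := by
  classical
  by_cases hle : f.coeff n₀ ≤ 0
  · exact NsdLoneRankOne.card_posRoots_succ_le_two_mul_card f T hT hn₀ habove hle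
  · push Not at hle
    have hT' : ∀ n, f.coeff n < 0 → n ∈ T.erase n₀ := by
      intro n hn
      refine Finset.mem_erase.mpr ⟨?_, hT n hn⟩
      rintro rfl
      exact absurd hn (not_lt.mpr hle.le)
    have h := card_posRoots_le_two_mul_card f (T.erase n₀) hT'
    rw [Finset.card_erase_of_mem hn₀] at h
    have h0 : 0 < T.card := Finset.card_pos.mpr ⟨n₀, hn₀⟩
    omega

/-! ## 2. Gen 26's index-graded count with one end (size `m`, stated with the top facts as hypotheses) -/

/-- **Index-graded law with a top element** (size `m ≥ 1`; `J + WWᵀ ⪰ 0` with `W` of width `q ≥ 1`; PSD letters): if no coefficient of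
`det F` lies above `n₀ = e + (m − 1)·d k₀`, then `Z₊ + 1 ≤ 2·∑_{j odd ≤ min q m} C(K + m − j, K)`.  The negative-support part is gen 26's
`pivotRootLawAt_indexGraded` verbatim. [folklore] -/
theorem indexGraded_succ_of_top (e : ℕ) (d : Fin K → ℕ) (J : Matrix (Fin m) (Fin m) ℝ) (P : Fin K → Matrix (Fin m) (Fin m) ℝ)
    (hP : ∀ k, (P k).PosSemidef) (W : Matrix (Fin m) (Fin q) ℝ) (hW : (J + W * Wᵀ).PosSemidef) (hq : 0 < q) (hm : 0 < m)
    (k₀ : Fin K) {n₀ : ℕ} (hn₀ : n₀ = e + (m - 1) * d k₀)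
    (habove : ∀ n, n₀ < n → (Matrix.det (((X : ℝ[X]) ^ e) • J.map Polynomial.C
        + ∑ k, ((X : ℝ[X]) ^ d k) • (P k).map Polynomial.C)).coeff n = 0) :
    pivotPosRoots e d J P + 1
      ≤ 2 * ((Finset.range (min q m + 1)).filter (fun j => Odd j)).sum (fun j => Nat.choose (K + m - j) K) := by
  classical
  obtain ⟨S₀, hS₀⟩ := ResolventDescartes.exists_eq_mul_transpose (J + W * Wᵀ) hW
  choose S hS using fun k => ResolventDescartes.exists_eq_mul_transpose (P k) (hP k)
  unfold pivotPosRoots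
  set σ := (Option (Fin K) × Fin m) ⊕ Fin q with hσ
  set ε : σ ≃ Fin (Fintype.card σ) := Fintype.equivFin σ with hε
  set sgσ : σ → ℝ := Sum.elim (fun _ => (1 : ℝ)) (fun _ => -1) with hsg
  set exσ : σ → ℕ := Sum.elim (fun oc => oc.1.elim e d) (fun _ => e) with hex
  -- the odd-level exponent set
  set T : Finset ℕ := ((Finset.range (min q m + 1)).filter (fun j => Odd j)).biUnion
      (fun j => (Finset.univ : Finset (Sym (Option (Fin K)) (m - j))).image
        (fun s : Sym (Option (Fin K)) (m - j) => j * e + ((s : Multiset (Option (Fin K))).map (fun o => o.elim e d)).sum)) with hT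
  have hTcard : T.card ≤ ((Finset.range (min q m + 1)).filter (fun j => Odd j)).sum (fun j => Nat.choose (K + m - j) K) :=
    Finset.card_biUnion_le.trans (card_oddImage_le e d m q)
  -- the top exponent `e + (m − 1)·d k₀` is the odd level `j = 1` with the multiset `{k₀, …, k₀}`
  have hn₀T : e + (m - 1) * d k₀ ∈ T := by
    rw [hT]
    refine Finset.mem_biUnion.mpr ⟨1, Finset.mem_filter.mpr ⟨Finset.mem_range.mpr (by omega), odd_one⟩, ?_⟩
    refine Finset.mem_image.mpr ⟨Sym.replicate (m - 1) (some k₀), Finset.mem_univ _, ?_⟩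
    rw [Sym.coe_replicate, Multiset.map_replicate, Multiset.sum_replicate, smul_eq_mul, one_mul]
    rfl
  rw [hn₀] at habove
  refine (card_posRoots_succ_le_two_mul_card_of_top_mem _ T (fun n hn => ?_) hn₀T habove).trans (Nat.mul_le_mul_left 2 hTcard)
  rw [pencil_eq_gram e d J P W S₀ S hS₀ hS ε] at hn
  -- a negative coefficient comes from a column selection with an ODD number of negative columns
  by_contra hnT
  refine absurd hn (not_lt.2 ?_)
  rw [GramExpansion.coeff_det_gramPencil]
  refine Finset.sum_nonneg fun t ht => ?_
  have htinj : Function.Injective t := (Finset.mem_filter.1 ht).2.injective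
  split_ifs with hsum
  swap
  · exact le_rfl
  -- the set `A` of rows whose selected column is a negative column
  set A : Finset (Fin m) := Finset.univ.filter (fun a => ∃ c, ε.symm (t a) = Sum.inr c) with hA
  have hsign : ∏ a, sgσ (ε.symm (t a)) = (-1 : ℝ) ^ A.card := by
    rw [← Finset.prod_filter_mul_prod_filter_not Finset.univ (fun a => ∃ c, ε.symm (t a) = Sum.inr c), ← hA]
    have h1 : ∏ a ∈ A, sgσ (ε.symm (t a)) = (-1 : ℝ) ^ A.card := by
      rw [← Finset.prod_const]
      refine Finset.prod_congr rfl fun a ha => ?_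
      obtain ⟨c, hc⟩ := (Finset.mem_filter.mp (hA ▸ ha)).2
      rw [hc, hsg, Sum.elim_inr]
    have h2 : ∏ a ∈ Finset.univ.filter (fun a => ¬ ∃ c, ε.symm (t a) = Sum.inr c), sgσ (ε.symm (t a)) = 1 := by
      refine Finset.prod_eq_one fun a ha => ?_
      have hno := (Finset.mem_filter.mp ha).2
      rcases hx : ε.symm (t a) with oc | c
      · rw [hsg, Sum.elim_inl]
      · exact absurd ⟨c, hx⟩ hno
    rw [h1, h2, mul_one]
  by_cases hpar : Even A.card
  · -- even number of negative columns: non-negative term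
    change 0 ≤ (∏ a, sgσ (ε.symm (t a))) * _
    rw [hsign, hpar.neg_one_pow, one_mul]
    exact sq_nonneg _
  · -- odd: the exponent lies in `T`
    exfalso
    have hodd : Odd A.card := Nat.not_even_iff_odd.mp hpar
    -- letters of the other rows
    have hother : ∀ a, a ∉ A → ∃ oc : Option (Fin K) × Fin m, ε.symm (t a) = Sum.inl oc := by
      intro a ha
      rcases hx : ε.symm (t a) with oc | c
      · exact ⟨oc, rfl⟩
      · exact absurd (Finset.mem_filter.mpr ⟨Finset.mem_univ _, ⟨c, hx⟩⟩) ha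
    choose! oc hoc using hother
    set s : Multiset (Option (Fin K)) := (Finset.univ \ A).val.map (fun a => (oc a).1) with hs
    have hAq : A.card ≤ q := by
      -- the negative columns used by the rows of `A` are distinct
      rcases Nat.eq_zero_or_pos q with hq0 | hq0
      · subst hq0
        have : A = ∅ := by
          rw [Finset.eq_empty_iff_forall_notMem]
          intro a ha
          obtain ⟨c, _⟩ := (Finset.mem_filter.mp (hA ▸ ha)).2
          exact Fin.elim0 c
        rw [this, Finset.card_empty]
      · have hinj : ∀ a b, ε.symm (t a) = ε.symm (t b) → a = b := fun a b h => htinj (ε.symm.injective h)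
        let col : Fin m → Fin q := fun a => (ε.symm (t a)).elim (fun _ => ⟨0, hq0⟩) id
        have : A.card ≤ (Finset.univ : Finset (Fin q)).card := by
          refine Finset.card_le_card_of_injOn col (fun _ _ => Finset.mem_univ _) ?_
          intro a ha b hb hab
          obtain ⟨ca, hca⟩ := (Finset.mem_filter.mp (hA ▸ Finset.mem_coe.mp ha)).2
          obtain ⟨cb, hcb⟩ := (Finset.mem_filter.mp (hA ▸ Finset.mem_coe.mp hb)).2
          have hc : ca = cb := by simpa [col, hca, hcb] using hab
          exact hinj a b (by rw [hca, hcb, hc])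
        simpa using this
    have hscard : Multiset.card s = m - A.card := by
      rw [hs, Multiset.card_map, Finset.card_val, Finset.card_sdiff, Finset.inter_univ, Finset.card_univ, Fintype.card_fin]
    have hAm : A.card ≤ m := (Finset.card_le_univ A).trans (by rw [Fintype.card_fin])
    apply hnT
    rw [hT]
    refine Finset.mem_biUnion.mpr ⟨A.card, Finset.mem_filter.mpr ⟨Finset.mem_range.mpr ?_, hodd⟩, ?_⟩
    · have := Nat.le_min.mpr ⟨hAq, hAm⟩; omega
    refine Finset.mem_image.mpr ⟨⟨s, hscard⟩, Finset.mem_univ _, ?_⟩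
    -- the exponent: negative columns contribute `e` each, the others their letter exponents
    rw [hsum, ← Finset.sum_filter_add_sum_filter_not Finset.univ (fun a => ∃ c, ε.symm (t a) = Sum.inr c), ← hA]
    have hneg : ∑ a ∈ A, exσ (ε.symm (t a)) = A.card * e := by
      rw [Finset.sum_const_nat fun a ha => ?_]
      obtain ⟨c, hc⟩ := (Finset.mem_filter.mp (hA ▸ ha)).2
      rw [hc, hex, Sum.elim_inr]
    have hset : Finset.univ.filter (fun a => ¬ ∃ c, ε.symm (t a) = Sum.inr c) = Finset.univ \ A := by
      ext a; simp [hA]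
    have hpos : ∑ a ∈ Finset.univ.filter (fun a => ¬ ∃ c, ε.symm (t a) = Sum.inr c), exσ (ε.symm (t a))
        = (s.map fun o => o.elim e d).sum := by
      rw [hs, Multiset.map_map, Function.comp_def, ← Finset.sum_map_val, hset]
      refine Finset.sum_congr rfl fun a ha => ?_
      have ha' : a ∉ A := (Finset.mem_sdiff.mp ha).2
      rw [hoc a ha', hex, Sum.elim_inl]
    change (A.card * e + (s.map fun o => o.elim e d).sum) = _
    rw [hneg, hpos]

/-! ## 3. The singular lone letter costs one root — any index, every size -/

/-- **`(K−1 | 1)` with a SINGULAR lone upper letter, any index, size `m + 1`.**  Pivot of index `≤ q` (`J + WWᵀ ⪰ 0`, `q ≥ 1`), PSD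
letters, one letter `k₀` strictly above the pivot exponent with `det P_{k₀} = 0`, all others strictly below ⇒
`Z₊ + 1 ≤ 2·∑_{j odd ≤ min q (m+1)} C(K + m + 1 − j, K)` (gen 26's index-graded budget minus one). [folklore] -/
theorem indexGraded_succ_of_lone_above (e : ℕ) (d : Fin K → ℕ) (J : Matrix (Fin (m + 1)) (Fin (m + 1)) ℝ)
    (P : Fin K → Matrix (Fin (m + 1)) (Fin (m + 1)) ℝ) (hP : ∀ k, (P k).PosSemidef) (W : Matrix (Fin (m + 1)) (Fin q) ℝ)
    (hW : (J + W * Wᵀ).PosSemidef) (hq : 0 < q) (k₀ : Fin K) (htop : e < d k₀) (hlow : ∀ k, k ≠ k₀ → d k < e)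
    (hrk : (P k₀).det = 0) :
    pivotPosRoots e d J P + 1
      ≤ 2 * ((Finset.range (min q (m + 1) + 1)).filter (fun j => Odd j)).sum (fun j => Nat.choose (K + (m + 1) - j) K) :=
  indexGraded_succ_of_top e d J P hP W hW hq (Nat.succ_pos m) k₀ (n₀ := e + m * d k₀) (by simp)
    (fun n hn => NsdLoneSingular.coeff_det_eq_zero_above e d J P k₀ htop hlow hrk hn)

/-- **`(1 | K−1)` with a SINGULAR lone lower letter, any index, size `m + 1`** (mirror by `x ↦ 1/x`). [folklore] -/
theorem indexGraded_succ_of_lone_below (e : ℕ) (d : Fin K → ℕ) (J : Matrix (Fin (m + 1)) (Fin (m + 1)) ℝ)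
    (P : Fin K → Matrix (Fin (m + 1)) (Fin (m + 1)) ℝ) (hP : ∀ k, (P k).PosSemidef) (W : Matrix (Fin (m + 1)) (Fin q) ℝ)
    (hW : (J + W * Wᵀ).PosSemidef) (hq : 0 < q) (k₀ : Fin K) (hbot : d k₀ < e) (hup : ∀ k, k ≠ k₀ → e < d k)
    (hrk : (P k₀).det = 0) :
    pivotPosRoots e d J P + 1
      ≤ 2 * ((Finset.range (min q (m + 1) + 1)).filter (fun j => Odd j)).sum (fun j => Nat.choose (K + (m + 1) - j) K) := by
  classical
  set N : ℕ := e + ∑ k, d k with hN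
  have he : e ≤ N := by rw [hN]; exact Nat.le_add_right _ _
  have hdN : ∀ k, d k ≤ N := fun k => by
    rw [hN]
    exact (Finset.single_le_sum (fun i _ => Nat.zero_le (d i)) (Finset.mem_univ k)).trans (Nat.le_add_left _ _)
  rw [← Reverse.pivotPosRoots_reverse N e d J P he hdN]
  refine indexGraded_succ_of_lone_above (N - e) (fun k => N - d k) J P hP W hW hq k₀ ?_ ?_ hrk
  · have := hdN k₀; omega
  · intro k hk
    have := hup k hk; have := hdN k; omega

/-- **Index one, every size**: a pivot pencil of size `m + 1` with `J + wwᵀ ⪰ 0` (`w` a column), PSD letters, and a SINGULAR lone upper letter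
has `Z₊ + 1 ≤ 2·C(K + m, K)` — the resolvent–Descartes budget minus one. [folklore] -/
theorem indexOne_succ_of_lone_above (e : ℕ) (d : Fin K → ℕ) (J : Matrix (Fin (m + 1)) (Fin (m + 1)) ℝ)
    (P : Fin K → Matrix (Fin (m + 1)) (Fin (m + 1)) ℝ) (hP : ∀ k, (P k).PosSemidef) (w : Matrix (Fin (m + 1)) (Fin 1) ℝ)
    (hW : (J + w * wᵀ).PosSemidef) (k₀ : Fin K) (htop : e < d k₀) (hlow : ∀ k, k ≠ k₀ → d k < e) (hrk : (P k₀).det = 0) :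
    pivotPosRoots e d J P + 1 ≤ 2 * Nat.choose (K + m) K := by
  have h := indexGraded_succ_of_lone_above e d J P hP w hW Nat.one_pos k₀ htop hlow hrk
  have hodd : ∀ f : ℕ → ℕ, ((Finset.range (min 1 (m + 1) + 1)).filter (fun j => Odd j)).sum f = f 1 := by
    intro f
    rw [show min 1 (m + 1) + 1 = 2 by omega, Finset.sum_filter, Finset.sum_range_succ, Finset.sum_range_succ, Finset.sum_range_zero]
    simp
  rw [hodd] at h
  simpa using h

end Summit.ValiantsHypothesis.ValiantsHypothesis.Theorems.LacunarySymmetroidMatrixDescartes.Pivot.IndexGradedLoneSingular
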